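import Mathlib.Data.Finset.NoncommProd
import Mathlib.Algebra.BigOperators.Ring.Finset
import Mathlib.Algebra.BigOperators.Group.Finset.Powerset
import Literature.Probability.LatticeModels.PercolationRowEdgeOperators
import HarnessLib

/-!
# The percolation row transfer matrix as a product of single-bond Temperley–Lieb factors

Companion to `PercolationRowTransfer.lean` and `PercolationRowEdgeOperators.lean`: item (5) of
the definition request `PercolationRowTransfer` (route `CriticalPhenomena/CardyPolygonWords`). The
stochastic row-to-row transfer matrix `T_S` of bond percolation on `ℤ²` at `p = 1/2`, acting on
distributions over connectivity states (`transferLin S : μ ↦ μ ᵥ* T_S`), factorises as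

  `T_S = (∏_{e ∈ hEdges S} (1 + J_e)/2) ∘ (∏_{x ∈ S} (1 + D_x)/2)`

(`transferLin_eq_noncommProd`; vertical bonds first, then horizontal bonds; the factors of each
kind commute, `Finset.noncommProd`), where `D_x`, `J_x` are the detach / join generators of the
Temperley–Lieb algebra at loop weight `1` in the connectivity representation and
`(1 + D_x)/2 = vertFactor x`, `(1 + J_e)/2 = horizFactor e` are the single-bond transfer factors at
`p = 1/2`. This is the lattice statement "each vertex corresponds to a node transfer matrix equal
to the identity plus the Temperley Lieb generator" (Bondesan–Jacobsen–Saleur, arXiv:1207.7005,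
§5.5; here normalised to a stochastic operator) in the factorised form `T(L) = H₁⋯H_L V₁⋯V_L` of
Jacobsen–Zinn-Justin (arXiv:cond-mat/0111374, §4) — the double-row transfer matrix of the
`Q = 1` Potts / dense `O(n = 1)` loop model at its isotropic critical point (Blöte–Nightingale 1982).

Steps: `statePushforward_id'`, `statePushforward_comp` (functoriality of push-forward);
`transferLin_eq_average` (`T_S` is the average of the deterministic push-forwards along
`rowStep O H` over the `2^|S| · 2^|hEdges S|` bond configurations); `statePushforward_rowStep`
(vertical layer, then horizontal layer); `noncommProd_vertFactor`, `noncommProd_horizFactor`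
(expanding the products of `(1 + D_x)/2`, `(1 + J_e)/2` over subsets = closed vertical / open
horizontal bonds).
-/

noncomputable section

open Finset Matrix
open scoped BigOperators Classical

namespace Literature.Probability.LatticeModels

/-! ### Functoriality of the push-forward of distributions -/

section Pushforward

variable {ι κ ν : Type*} [Fintype ι] [Fintype κ]

omit [Fintype κ] in
/-- Unfolding lemma for `statePushforward`. [folklore] -/
theorem statePushforward_apply (f : ι → κ) (μ : ι → ℝ) (k : κ) :
    statePushforward f μ k = ∑ i ∈ univ.filter (fun i => f i = k), μ i :=
  rfl

/-- Push-forward along the identity is the identity. [folklore] -/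
theorem statePushforward_id' : statePushforward (fun i : ι => i) = (1 : Module.End ℝ (ι → ℝ)) := by
  refine LinearMap.ext fun μ => funext fun k => ?_
  rw [statePushforward_apply, Finset.filter_eq' univ k, if_pos (mem_univ k), sum_singleton]
  rfl

/-- Push-forward is functorial: `(g ∘ f)_* = g_* ∘ f_*`. [folklore] -/
theorem statePushforward_comp (g : κ → ν) (f : ι → κ) :
    statePushforward (g ∘ f) = statePushforward g ∘ₗ statePushforward f := by
  refine LinearMap.ext fun μ => funext fun n => ?_
  rw [LinearMap.comp_apply, statePushforward_apply, statePushforward_apply]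
  simp_rw [statePushforward_apply]
  symm
  have hmaps : ∀ i ∈ univ.filter (fun i => (g ∘ f) i = n), f i ∈ univ.filter (fun k => g k = n) := by
    intro i hi
    simpa using hi
  rw [← Finset.sum_fiberwise_of_maps_to hmaps]
  refine Finset.sum_congr rfl fun k hk => Finset.sum_congr ?_ fun _ _ => rfl
  ext i
  simp only [mem_filter, mem_univ, true_and, Function.comp_apply, iff_and_self]
  intro hi
  rw [hi]
  simpa using hk

/-- Functoriality for endomorphisms: `(g ∘ f)_* = g_* * f_*` in `Module.End`. [folklore] -/
theorem statePushforward_comp_mul (g f : ι → ι) :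
    statePushforward (g ∘ f) = statePushforward g * statePushforward (κ := ι) f :=
  statePushforward_comp g f

end Pushforward

variable {S : Finset ℤ}

/-! ### The transfer matrix as an average of deterministic steps -/

/-- **`T_S` is the uniform average of the push-forwards along the deterministic row steps**
`rowStep O H`, over the `2^|S|` vertical and `2^|hEdges S|` horizontal bond configurations.
[cite: JacobsenZinnjustin2001, §4] -/
theorem transferLin_eq_average (S : Finset ℤ) :
    transferLin S = ((2 : ℝ) ^ S.card * 2 ^ (hEdges S).card)⁻¹ •
      ∑ OH ∈ (univ : Finset (Finset S)) ×ˢ (hEdges S).powerset,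
        statePushforward (rowStep OH.1 OH.2) := by
  refine LinearMap.ext fun μ => funext fun π' => ?_
  simp only [transferLin, Matrix.vecMulLinear_apply, Matrix.vecMul, dotProduct,
    LinearMap.smul_apply, LinearMap.coe_sum, Finset.sum_apply, Pi.smul_apply, smul_eq_mul,
    statePushforward_apply, PercolationRowTransfer]
  simp_rw [Finset.sum_filter, div_eq_mul_inv]
  rw [Finset.sum_comm, Finset.mul_sum]
  refine Finset.sum_congr rfl fun π _ => ?_
  rw [← Finset.sum_filter, Finset.sum_const, nsmul_eq_mul]
  ring

/-- The push-forward along a row step: vertical layer, then horizontal layer.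
[cite: JacobsenZinnjustin2001, §4] -/
theorem statePushforward_rowStep (O H : Finset S) :
    statePushforward (rowStep O H) =
      statePushforward (rowStep univ H) * statePushforward (rowStep O ∅ : RowState S → RowState S) := by
  rw [← statePushforward_comp_mul]
  congr 1
  funext π
  exact rowStep_eq_horiz_vert O H π

/-! ### Expanding the products of single-bond factors -/

/-- `D_x` and `D_y` commute as push-forwards. [folklore] -/
theorem statePushforward_detach_comm (x y : S) :
    statePushforward (RowState.detach x) * statePushforward (RowState.detach y) =
      statePushforward (RowState.detach y) * statePushforward (κ := RowState S) (RowState.detach x) := by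
  rw [← statePushforward_comp_mul, ← statePushforward_comp_mul]
  congr 1
  funext π
  exact RowState.detach_comm x y π

/-- `J_x` and `J_y` commute as push-forwards. [folklore] -/
theorem statePushforward_join_comm (x y : S) :
    statePushforward (RowState.join x) * statePushforward (RowState.join y) =
      statePushforward (RowState.join y) * statePushforward (κ := RowState S) (RowState.join x) := by
  rw [← statePushforward_comp_mul, ← statePushforward_comp_mul]
  congr 1
  funext π
  exact RowState.join_comm x y π

/-- The vertical single-bond factors commute. [folklore] -/
theorem vertFactor_commute (x y : S) : Commute (vertFactor x) (vertFactor y) := by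
  unfold vertFactor
  refine Commute.smul_left (Commute.smul_right ?_ _) _
  exact (Commute.one_left _).add_left
    ((Commute.one_right _).add_right (statePushforward_detach_comm x y))

/-- The horizontal single-bond factors commute. [folklore] -/
theorem horizFactor_commute (x y : S) : Commute (horizFactor x) (horizFactor y) := by
  unfold horizFactor
  refine Commute.smul_left (Commute.smul_right ?_ _) _
  exact (Commute.one_left _).add_left
    ((Commute.one_right _).add_right (statePushforward_join_comm x y))

/-- **Expanding `∏_{x ∈ A} (1 + D_x)/2`**: the average over the sets `D ⊆ A` of closed vertical
bonds of the push-forward along the vertical layer with exactly those bonds closed.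
[cite: JacobsenZinnjustin2001, §4] -/
theorem noncommProd_vertFactor (A : Finset S) :
    A.noncommProd vertFactor (fun x _ y _ _ => vertFactor_commute x y) =
      ((2 : ℝ) ^ A.card)⁻¹ • ∑ D ∈ A.powerset, statePushforward (rowStep (univ \ D) ∅) := by
  induction A using Finset.induction_on with
  | empty =>
    rw [Finset.noncommProd_empty, card_empty, pow_zero, inv_one, one_smul, powerset_empty,
      sum_singleton, sdiff_empty]
    have h : (rowStep univ ∅ : RowState S → RowState S) = fun π => π := funext rowStep_univ_empty
    rw [h, statePushforward_id']
  | insert a A ha ih =>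
    rw [Finset.noncommProd_insert_of_notMem _ _ _ _ ha, ih, Finset.sum_powerset_insert ha,
      card_insert_of_notMem ha, vertFactor]
    rw [smul_mul_smul_comm, add_mul, one_mul, Finset.mul_sum, smul_add]
    have hstep : ∀ D ∈ A.powerset,
        statePushforward (RowState.detach a) * statePushforward (rowStep (univ \ D) ∅) =
          statePushforward (rowStep (univ \ insert a D) ∅ : RowState S → RowState S) := by
      intro D _
      rw [← statePushforward_comp_mul]
      congr 1
      funext π
      rw [Function.comp_apply, ← rowStep_erase_empty, sdiff_insert]
    rw [Finset.sum_congr rfl hstep, ← smul_add]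
    congr 1
    rw [pow_succ, mul_inv, mul_comm]

/-- **Expanding `∏_{e ∈ A} (1 + J_e)/2`**: the average over the sets `H ⊆ A` of open horizontal
bonds of the push-forward along the horizontal layer opening exactly those bonds.
[cite: JacobsenZinnjustin2001, §4] -/
theorem noncommProd_horizFactor (A : Finset S) :
    A.noncommProd horizFactor (fun x _ y _ _ => horizFactor_commute x y) =
      ((2 : ℝ) ^ A.card)⁻¹ • ∑ H ∈ A.powerset, statePushforward (rowStep univ H) := by
  induction A using Finset.induction_on with
  | empty =>
    rw [Finset.noncommProd_empty, card_empty, pow_zero, inv_one, one_smul, powerset_empty,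
      sum_singleton]
    have h : (rowStep univ ∅ : RowState S → RowState S) = fun π => π := funext rowStep_univ_empty
    rw [h, statePushforward_id']
  | insert a A ha ih =>
    rw [Finset.noncommProd_insert_of_notMem _ _ _ _ ha, ih, Finset.sum_powerset_insert ha,
      card_insert_of_notMem ha, horizFactor]
    rw [smul_mul_smul_comm, add_mul, one_mul, Finset.mul_sum, smul_add]
    have hstep : ∀ H ∈ A.powerset,
        statePushforward (RowState.join a) * statePushforward (rowStep univ H) =
          statePushforward (rowStep univ (insert a H) : RowState S → RowState S) := by
      intro H _
      rw [← statePushforward_comp_mul]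
      congr 1
      funext π
      rw [Function.comp_apply, ← rowStep_insert]
    rw [Finset.sum_congr rfl hstep, ← smul_add]
    congr 1
    rw [pow_succ, mul_inv, mul_comm]

/-! ### The product formula -/

/-- **`T_S = ∏_e (1 + J_e)/2 ∘ ∏_x (1 + D_x)/2`**: the stochastic row transfer matrix of bond
percolation at `p = 1/2` (on distributions, `μ ↦ μ ᵥ* T_S`) is the product of the single-bond
Temperley–Lieb factors — all vertical bonds (in any order), then all horizontal bonds (in any
order): the node transfer matrices "identity plus the Temperley–Lieb generator" of the loop model
at the percolation point, normalised to probability `1/2` per bond.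
[cite: BondesanJacobsenSaleur2012, §5.5] -/
theorem transferLin_eq_noncommProd (S : Finset ℤ) :
    transferLin S =
      (hEdges S).noncommProd horizFactor (fun x _ y _ _ => horizFactor_commute x y) *
        (univ : Finset S).noncommProd vertFactor (fun x _ y _ _ => vertFactor_commute x y) := by
  rw [noncommProd_horizFactor, noncommProd_vertFactor, transferLin_eq_average, smul_mul_smul_comm,
    Finset.sum_mul_sum, Finset.sum_product, Finset.sum_comm, card_univ, Fintype.card_coe, mul_comm,
    mul_inv]
  congr 1
  refine Finset.sum_congr rfl fun H _ => ?_
  -- reindex the closed vertical bonds `D` by the open ones `O = univ \ D`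
  rw [powerset_univ]
  refine Fintype.sum_equiv (Equiv.refl _ |>.trans ⟨compl, compl, compl_compl, compl_compl⟩)
    _ _ fun O => ?_
  show statePushforward (rowStep (O, H).1 (O, H).2) =
    statePushforward (rowStep univ H) * statePushforward (rowStep (univ \ Oᶜ) ∅)
  rw [← compl_eq_univ_sdiff, compl_compl]
  exact statePushforward_rowStep O H

end Literature.Probability.LatticeModels

end
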